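import Mathlib
import HarnessLib
import Literature.Analysis.FluidPDE.VectorCalculus

/-!
# Door S20 «ChiralWindowDoor» (nsreg-p1 ROUND-19, design-only) — the typed substrate

Door S20 of nsreg-p1's local Type-I door family (`HOME/ns-regularity-ideate-p1/r19/ROUND-19-DRAFT.md`, texts
`r19/Sketch20v4.lean` 20ef4abc247f95cb, line `r19/Sketch20v5.lean` 7f13084196f4f031; DESIGN-ONLY, route NOT born):
a classical Leray–Hopf flow, locally space–time Type I at `(x₀,T)`, whose scale-normalised CHIRALITY DEFECT
`(curl − Λ)(zoomed slice)` fades in `L¹` on one similarity window is regular at `(x₀,T)` — PROVIDED chiral Type-I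
ancient mild profiles (`curl v = Λ v`, the non-local Beltrami condition of Lei–Lin–Zhou 2015 Prop. 2.1, i.e. the
negative helical component vanishes) are not backward-singular (K2).  The residue line of K2 (R19-LINE B0–B5) runs on
a localised helicity budget written WITHOUT Fourier analysis: `Λ = (−Δ)^{1/2}` in absolutely convergent
second-difference kernel form and the weighted Gagliardo (Aronszajn–Slobodeckij) quadratic form.

This file fixes that vocabulary ONCE in the tree, with the texts of `r19/Sketch20v5.lean` VERBATIM (so that the
support-cone theorems of the door and, if the door is ever born, its route texts cite tree declarations instead of
re-declaring them):

* `lamK z = π⁻² ‖z‖⁻⁴` — the kernel of `Λ = (−Δ)^{1/2}` on `ℝ³` (constant `C(3,½) = π⁻²`, the value of the tree's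
  `fracDerivConst 1` of `HypodissipativeNSForcedBlowup.lean`, whose FIRST-difference `fracDeriv 1` is a principal value
  and hence junk as a Bochner integral — the reason for the second-difference form here); `lamKTrunc ε` its truncation
  `lamK · 1_{‖z‖>ε}` (the B1′/B2′ truncation scheme);
* `fracLapHalf f x = ½ ∫ lamK z • (2 f x − f (x+z) − f (x−z)) dz` (vector fields) and `fracLapHalfS` (scalars);
* `IsChiral u : ∀ x, curl u x = fracLapHalf u x`;
* `HasTypeIDerivDecay K v` — R19's space–time derivative binder (`∇v, ∇²v, ∂ₜv` with powers `2, 3, 3`; a THEOREM of the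
  door class, `…Theorems.ChiralWindowDoorClassDerivDecay.derivDecay_of_class`, kept as a named hypothesis because the
  line's stub texts carry it);
* `gagliardo a f = ¼ ∬ (a x + a y) lamK (x−y) ‖f x − f y‖²`, `locHelicity a v = ∫ a ⟪v, curl v⟫`,
  `IsAdmissibleBump η`, `bumpSq η R y = η(R⁻¹y)²`;
* the three product-space integrands `symF`, `symG`, `symS` of the symmetrisation identity
  `h(a,f) = G(a,f) + ½∫‖f‖² Λa` (nsreg-p1 `r19/Symmetrisation.lean`), for a general even kernel `K`.

Only the small algebra needed to USE the definitions is proved here (non-negativity, evenness, truncation comparisons,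
integrability of the truncated kernel on `ℝ³`, the junk-free non-negativity of the Gagliardo form, existence of an
admissible bump); the symmetrisation identity, the well-definedness of `Λ` on `C²_b` fields, the zoom covariance and
the line's stubs live in the `ChiralWindowDoor*` theorem files.  `lean search` 2026-08-27: no whole-space `(−Δ)^{1/2}`,
Gagliardo form or localised helicity on `EuclideanSpace ℝ (Fin 3)` exists in `Literature`/`Summits` (the torus
`Torus.fracLaplacian`, the first-difference `fracDeriv`, `Chebiam2025.gagliardo` on sets with exponent pairs and the
`BrezisConstantFunctions` `lintegral_gagliardo…` are different objects).

Seat nsreg-p6 g11 (THEOREMS-ONLY door sequels, DIRECTOR-NS g8 #32 (2)/#36); texts by nsreg-p1 g16/g17.  WHAT THIS IS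
NOT: not NS regularity (Clay A); not a statement about S20's cruxes; vocabulary only; no route is opened.
-/

noncomputable section

-- the summit and its single sub-problem share the name (CONVENTIONS §1), as in every Theorems file
set_option linter.dupNamespace false

namespace Summit.NavierStokesRegularity.NavierStokesRegularity.Theorems.ChiralWindowDoorDefs

open MeasureTheory Set
open scoped RealInnerProductSpace
open Literature.Analysis Literature.Analysis.FluidPDE

/-! ### The kernel of `Λ = (−Δ)^{1/2}` on `ℝ³` and its truncations -/

/-- The kernel of `Λ = (−Δ)^{1/2}` on `ℝ³`: `π⁻² ‖z‖⁻⁴` (constant `C(3,½) = 4^{1/2}Γ(2)/(π^{3/2}|Γ(−½)|) = π⁻²`).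
Text of nsreg-p1 `r19/Sketch20v5.lean`, verbatim. -/
def lamK (z : EuclideanSpace ℝ (Fin 3)) : ℝ := (1 / Real.pi ^ 2) * (‖z‖ ^ 4)⁻¹

/-- The truncated kernel `K_ε = lamK · 1_{‖z‖ > ε}` (nsreg-p1 `r19/KernelFacts.lean`). -/
def lamKTrunc (ε : ℝ) (z : EuclideanSpace ℝ (Fin 3)) : ℝ := if ε < ‖z‖ then lamK z else 0

/-- `lamK ≥ 0`. -/
theorem lamK_nonneg (z : EuclideanSpace ℝ (Fin 3)) : 0 ≤ lamK z := by unfold lamK; positivity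

/-- `lamK` is even. -/
theorem lamK_neg (z : EuclideanSpace ℝ (Fin 3)) : lamK (-z) = lamK z := by simp [lamK, norm_neg]

/-- `lamK` is measurable. -/
theorem measurable_lamK : Measurable lamK := by unfold lamK; fun_prop

/-- Homogeneity of degree `−4`: `lamK z = γ⁴ · lamK (γ • z)` for `γ > 0` (nsreg-p1 `r19/ZoomCommutes.lean`). -/
theorem lamK_eq_smul (γ : ℝ) (hγ : 0 < γ) (z : EuclideanSpace ℝ (Fin 3)) : lamK z = γ ^ 4 * lamK (γ • z) := by
  unfold lamK
  rw [norm_smul, Real.norm_eq_abs, abs_of_pos hγ, mul_pow, mul_inv]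
  have hγ4 : γ ^ 4 ≠ 0 := by positivity
  field_simp

/-- `lamKTrunc ε ≥ 0`. -/
theorem lamKTrunc_nonneg (ε : ℝ) (z : EuclideanSpace ℝ (Fin 3)) : 0 ≤ lamKTrunc ε z := by
  unfold lamKTrunc; split_ifs <;> [exact lamK_nonneg z; exact le_rfl]

/-- `lamKTrunc ε` is even. -/
theorem lamKTrunc_neg (ε : ℝ) (z : EuclideanSpace ℝ (Fin 3)) : lamKTrunc ε (-z) = lamKTrunc ε z := by
  simp [lamKTrunc, norm_neg, lamK_neg]

/-- `lamKTrunc ε ≤ lamK`. -/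
theorem lamKTrunc_le_lamK (ε : ℝ) (z : EuclideanSpace ℝ (Fin 3)) : lamKTrunc ε z ≤ lamK z := by
  unfold lamKTrunc; split_ifs <;> [exact le_rfl; exact lamK_nonneg z]

/-- The truncations increase as `ε ↓`: `ε' ≤ ε ⇒ lamKTrunc ε ≤ lamKTrunc ε'`. -/
theorem lamKTrunc_mono {ε ε' : ℝ} (h : ε' ≤ ε) (z : EuclideanSpace ℝ (Fin 3)) :
    lamKTrunc ε z ≤ lamKTrunc ε' z := by
  unfold lamKTrunc
  split_ifs with h1 h2
  · exact le_rfl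
  · exact absurd (h.trans_lt h1) h2
  · exact lamK_nonneg z
  · exact le_rfl

/-- Off the ball of radius `ε` the truncation is the kernel. -/
theorem lamKTrunc_of_lt {ε : ℝ} {z : EuclideanSpace ℝ (Fin 3)} (h : ε < ‖z‖) : lamKTrunc ε z = lamK z := by
  unfold lamKTrunc; rw [if_pos h]

/-- Inside the closed ball of radius `ε` the truncation vanishes. -/
theorem lamKTrunc_of_le {ε : ℝ} {z : EuclideanSpace ℝ (Fin 3)} (h : ‖z‖ ≤ ε) : lamKTrunc ε z = 0 := by
  unfold lamKTrunc; rw [if_neg (not_lt.2 h)]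

/-- `lamKTrunc ε` is measurable. -/
theorem measurable_lamKTrunc (ε : ℝ) : Measurable (lamKTrunc ε) := by
  unfold lamKTrunc
  refine Measurable.ite ?_ measurable_lamK measurable_const
  exact measurableSet_lt measurable_const (by fun_prop)

/-- Pointwise domination of the truncated kernel by a Japanese bracket: for `0 < ε`,
`K_ε(z) ≤ π⁻² ((1+ε)/ε)⁴ (1+‖z‖)^{-4}` (nsreg-p1 `r19/KernelFacts.lean`). -/
theorem lamKTrunc_le_bracket {ε : ℝ} (hε : 0 < ε) (z : EuclideanSpace ℝ (Fin 3)) :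
    lamKTrunc ε z ≤ (1 / Real.pi ^ 2) * ((1 + ε) / ε) ^ 4 * (1 + ‖z‖) ^ (-(4 : ℝ)) := by
  have hR : 0 ≤ (1 / Real.pi ^ 2) * ((1 + ε) / ε) ^ 4 * (1 + ‖z‖) ^ (-(4 : ℝ)) := by positivity
  unfold lamKTrunc
  split_ifs with h
  · unfold lamK
    have hz : 0 < ‖z‖ := hε.trans h
    have hcmp : 1 + ‖z‖ ≤ (1 + ε) / ε * ‖z‖ := by
      rw [div_mul_eq_mul_div, le_div_iff₀ hε]; nlinarith
    have h4 : (1 + ‖z‖) ^ 4 ≤ ((1 + ε) / ε * ‖z‖) ^ 4 :=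
      pow_le_pow_left₀ (by positivity) hcmp 4
    rw [Real.rpow_neg (by positivity), show (4 : ℝ) = ((4 : ℕ) : ℝ) by norm_num, Real.rpow_natCast,
      mul_assoc]
    refine mul_le_mul_of_nonneg_left ?_ (by positivity)
    rw [mul_pow] at h4
    have hz4 : 0 < ‖z‖ ^ 4 := by positivity
    have h14 : 0 < (1 + ‖z‖) ^ 4 := by positivity
    rw [← div_eq_mul_inv, le_div_iff₀ h14, inv_mul_eq_div, div_le_iff₀ hz4]
    exact h4
  · exact hR

/-- **The truncated kernel is integrable on `ℝ³`** (`0 < ε`; domination by the Japanese bracket of exponent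
`4 > 3 = dim`, Mathlib `integrable_one_add_norm`) (nsreg-p1 `r19/KernelFacts.lean`). -/
theorem integrable_lamKTrunc {ε : ℝ} (hε : 0 < ε) : Integrable (lamKTrunc ε) := by
  have hdom : Integrable (fun z : EuclideanSpace ℝ (Fin 3) =>
      (1 / Real.pi ^ 2) * ((1 + ε) / ε) ^ 4 * (1 + ‖z‖) ^ (-(4 : ℝ))) := by
    have h := (integrable_one_add_norm (E := EuclideanSpace ℝ (Fin 3)) (μ := volume) (r := 4)
      (by rw [finrank_euclideanSpace_fin]; norm_num))
    exact h.const_mul _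
  refine hdom.mono' (measurable_lamKTrunc ε).aestronglyMeasurable (Filter.Eventually.of_forall fun z => ?_)
  rw [Real.norm_eq_abs, abs_of_nonneg (lamKTrunc_nonneg ε z)]
  exact lamKTrunc_le_bracket hε z

/-! ### `Λ = (−Δ)^{1/2}` in second-difference form; chirality -/

/-- `Λ f (x) = ½ ∫ lamK z • (2 f(x) − f(x+z) − f(x−z)) dz` — `(−Δ)^{1/2}` of a vector field on `ℝ³` in SECOND-DIFFERENCE
kernel form (absolutely convergent for bounded `C²` fields: `…ChiralWindowDoorLambda.integrable_fracLapHalf_integrand`;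
junk value `0` of the Bochner integral otherwise).  Text of nsreg-p1 `r19/Sketch20v5.lean`, verbatim. -/
def fracLapHalf (f : EuclideanSpace ℝ (Fin 3) → EuclideanSpace ℝ (Fin 3)) (x : EuclideanSpace ℝ (Fin 3)) :
    EuclideanSpace ℝ (Fin 3) :=
  (1 / 2 : ℝ) • ∫ z, lamK z • ((2 : ℝ) • f x - f (x + z) - f (x - z))

/-- Scalar version of `Λ`: `Λ a (x) = ½ ∫ lamK z · (2 a(x) − a(x+z) − a(x−z)) dz`.  Text of `r19/Sketch20v5.lean`,
verbatim. -/
def fracLapHalfS (a : EuclideanSpace ℝ (Fin 3) → ℝ) (x : EuclideanSpace ℝ (Fin 3)) : ℝ :=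
  (1 / 2 : ℝ) * ∫ z, lamK z * (2 * a x - a (x + z) - a (x - z))

/-- CHIRAL (positively helical, `u₋ ≡ 0`): the non-local Beltrami condition `curl u = Λ u` (Lei–Lin–Zhou 2015,
Prop. 2.1: `∇ × u₊ = Λ u₊`).  Text of `r19/Sketch20v5.lean`, verbatim. -/
def IsChiral (u : EuclideanSpace ℝ (Fin 3) → EuclideanSpace ℝ (Fin 3)) : Prop := ∀ x, curl u x = fracLapHalf u x

/-- Type-I SPACE–TIME decay of the first derivatives of an ancient profile (R19's binder): `(‖x‖+√(−t))²‖∇v‖ ≤ K`,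
`(‖x‖+√(−t))³‖∇²v‖ ≤ K`, `(‖x‖+√(−t))³‖∂ₜv‖ ≤ K` on `t < 0`.  Text of `r19/Sketch20v5.lean`, verbatim.  For every
door-class profile SOME `K` works: `…Theorems.ChiralWindowDoorClassDerivDecay.derivDecay_of_class` (whose conclusion is
this body under `∃ K`, definitionally). -/
def HasTypeIDerivDecay (K : ℝ) (v : ℝ → EuclideanSpace ℝ (Fin 3) → EuclideanSpace ℝ (Fin 3)) : Prop :=
  ∀ t < (0 : ℝ), ∀ x, (‖x‖ + Real.sqrt (-t)) ^ 2 * ‖fderiv ℝ (v t) x‖ ≤ K ∧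
    (‖x‖ + Real.sqrt (-t)) ^ 3 * ‖iteratedFDeriv ℝ 2 (v t) x‖ ≤ K ∧
    (‖x‖ + Real.sqrt (-t)) ^ 3 * ‖deriv (fun τ => v τ x) t‖ ≤ K

/-- Unfolding `HasTypeIDerivDecay` (for rewriting across namespaces). -/
theorem hasTypeIDerivDecay_iff (K : ℝ) (v : ℝ → EuclideanSpace ℝ (Fin 3) → EuclideanSpace ℝ (Fin 3)) :
    HasTypeIDerivDecay K v ↔
      ∀ t < (0 : ℝ), ∀ x, (‖x‖ + Real.sqrt (-t)) ^ 2 * ‖fderiv ℝ (v t) x‖ ≤ K ∧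
        (‖x‖ + Real.sqrt (-t)) ^ 3 * ‖iteratedFDeriv ℝ 2 (v t) x‖ ≤ K ∧
        (‖x‖ + Real.sqrt (-t)) ^ 3 * ‖deriv (fun τ => v τ x) t‖ ≤ K :=
  Iff.rfl

/-- The gradient conjunct of the binder in the form the energy ledger uses: `‖∇v(t,x)‖ ≤ K / (‖x‖+√(−t))²`. -/
theorem HasTypeIDerivDecay.norm_fderiv_le {K : ℝ} {v : ℝ → EuclideanSpace ℝ (Fin 3) → EuclideanSpace ℝ (Fin 3)}
    (h : HasTypeIDerivDecay K v) {t : ℝ} (ht : t < 0) (x : EuclideanSpace ℝ (Fin 3)) :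
    ‖fderiv ℝ (v t) x‖ ≤ K / (‖x‖ + Real.sqrt (-t)) ^ 2 := by
  have hpos : 0 < (‖x‖ + Real.sqrt (-t)) ^ 2 := by
    have : 0 < Real.sqrt (-t) := Real.sqrt_pos.2 (neg_pos.2 ht)
    positivity
  rw [le_div_iff₀ hpos, mul_comm]
  exact (h t ht x).1

/-- The binder forces `0 ≤ K` (evaluate at any point of any slice). -/
theorem HasTypeIDerivDecay.nonneg {K : ℝ} {v : ℝ → EuclideanSpace ℝ (Fin 3) → EuclideanSpace ℝ (Fin 3)}
    (h : HasTypeIDerivDecay K v) : 0 ≤ K :=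
  le_trans (by positivity) (h (-1) (by norm_num) 0).1

/-! ### The weighted Gagliardo form, the localised helicity, admissible bumps -/

/-- The WEIGHTED GAGLIARDO FORM `G(a,f) = ¼ ∬ (a(x)+a(y)) π⁻²‖x−y‖⁻⁴ ‖f(x)−f(y)‖²` (manifestly `≥ 0` for `a ≥ 0`; the
Bochner integral over `ℝ³ × ℝ³`, junk value `0` when the integrand is not integrable).  Text of `r19/Sketch20v5.lean`,
verbatim. -/
def gagliardo (a : EuclideanSpace ℝ (Fin 3) → ℝ) (f : EuclideanSpace ℝ (Fin 3) → EuclideanSpace ℝ (Fin 3)) : ℝ :=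
  (1 / 4 : ℝ) * ∫ p : EuclideanSpace ℝ (Fin 3) × EuclideanSpace ℝ (Fin 3),
    (a p.1 + a p.2) * (lamK (p.1 - p.2) * ‖f p.1 - f p.2‖ ^ 2)

/-- Localised helicity `h(a,v) = ∫ a ⟪v, curl v⟫`.  Text of `r19/Sketch20v5.lean`, verbatim. -/
def locHelicity (a : EuclideanSpace ℝ (Fin 3) → ℝ) (v : EuclideanSpace ℝ (Fin 3) → EuclideanSpace ℝ (Fin 3)) : ℝ :=
  ∫ x, a x * inner ℝ (v x) (curl v x)

/-- Admissible radial-type bump: `C²`, `= 1` on `B₁`, `= 0` off `B₂`, values in `[0,1]`.  Text of `r19/Sketch20v5.lean`,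
verbatim. -/
def IsAdmissibleBump (η : EuclideanSpace ℝ (Fin 3) → ℝ) : Prop :=
  ContDiff ℝ 2 η ∧ (∀ y, ‖y‖ ≤ 1 → η y = 1) ∧ (∀ y, 2 ≤ ‖y‖ → η y = 0) ∧ ∀ y, 0 ≤ η y ∧ η y ≤ 1

/-- The weight `a_R = η(·/R)²`.  Text of `r19/Sketch20v5.lean`, verbatim. -/
def bumpSq (η : EuclideanSpace ℝ (Fin 3) → ℝ) (R : ℝ) (y : EuclideanSpace ℝ (Fin 3)) : ℝ := η (R⁻¹ • y) ^ 2

/-- The weighted Gagliardo form is non-negative for a non-negative weight (no integrability needed: the Bochner integral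
of a pointwise non-negative function is `≥ 0`, junk value `0` included) (nsreg-p1 `r19/Sketch20v5.lean`). -/
theorem gagliardo_nonneg {a : EuclideanSpace ℝ (Fin 3) → ℝ} (ha : ∀ x, 0 ≤ a x)
    (f : EuclideanSpace ℝ (Fin 3) → EuclideanSpace ℝ (Fin 3)) : 0 ≤ gagliardo a f := by
  unfold gagliardo
  refine mul_nonneg (by norm_num) (integral_nonneg fun p => ?_)
  exact mul_nonneg (add_nonneg (ha _) (ha _)) (mul_nonneg (lamK_nonneg _) (by positivity))

/-- `bumpSq η R ≥ 0`. -/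
theorem bumpSq_nonneg (η : EuclideanSpace ℝ (Fin 3) → ℝ) (R : ℝ) (y : EuclideanSpace ℝ (Fin 3)) :
    0 ≤ bumpSq η R y := by
  unfold bumpSq; positivity

/-- For an admissible bump, `bumpSq η R ≤ 1`. -/
theorem bumpSq_le_one {η : EuclideanSpace ℝ (Fin 3) → ℝ} (hη : IsAdmissibleBump η) (R : ℝ)
    (y : EuclideanSpace ℝ (Fin 3)) : bumpSq η R y ≤ 1 := by
  obtain ⟨-, -, -, h01⟩ := hη
  unfold bumpSq
  have h0 := (h01 (R⁻¹ • y)).1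
  have h1 := (h01 (R⁻¹ • y)).2
  nlinarith

/-- For an admissible bump and `R > 0`, `bumpSq η R = 1` on the closed ball `‖y‖ ≤ R`. -/
theorem bumpSq_eq_one {η : EuclideanSpace ℝ (Fin 3) → ℝ} (hη : IsAdmissibleBump η) {R : ℝ} (hR : 0 < R)
    {y : EuclideanSpace ℝ (Fin 3)} (hy : ‖y‖ ≤ R) : bumpSq η R y = 1 := by
  obtain ⟨-, hone, -, -⟩ := hη
  unfold bumpSq
  have : ‖R⁻¹ • y‖ ≤ 1 := by
    rw [norm_smul, Real.norm_eq_abs, abs_of_pos (inv_pos.2 hR), inv_mul_le_iff₀ hR, mul_one]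
    exact hy
  rw [hone _ this, one_pow]

/-- For an admissible bump and `R > 0`, `bumpSq η R = 0` off the ball `‖y‖ < 2R`. -/
theorem bumpSq_eq_zero {η : EuclideanSpace ℝ (Fin 3) → ℝ} (hη : IsAdmissibleBump η) {R : ℝ} (hR : 0 < R)
    {y : EuclideanSpace ℝ (Fin 3)} (hy : 2 * R ≤ ‖y‖) : bumpSq η R y = 0 := by
  obtain ⟨-, -, hzero, -⟩ := hη
  unfold bumpSq
  have : 2 ≤ ‖R⁻¹ • y‖ := by
    rw [norm_smul, Real.norm_eq_abs, abs_of_pos (inv_pos.2 hR), le_inv_mul_iff₀ hR]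
    linarith
  rw [hzero _ this, zero_pow two_ne_zero]

/-- An admissible bump exists (from Mathlib's `ContDiffBump`) (nsreg-p1 `r19/Sketch20v5.lean`). -/
theorem exists_admissibleBump : ∃ η : EuclideanSpace ℝ (Fin 3) → ℝ, IsAdmissibleBump η := by
  let b : ContDiffBump (0 : EuclideanSpace ℝ (Fin 3)) := ⟨1, 2, one_pos, one_lt_two⟩
  refine ⟨b, b.contDiff, fun y hy => ?_, fun y hy => ?_, fun y => ⟨b.nonneg, b.le_one⟩⟩
  · exact b.one_of_mem_closedBall (by simpa using hy)
  · exact b.zero_of_le_dist (by simpa using hy)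

/-! ### The integrands of the symmetrisation identity (general even kernel `K`) -/

section Symmetrisation

variable (a : EuclideanSpace ℝ (Fin 3) → ℝ) (f : EuclideanSpace ℝ (Fin 3) → EuclideanSpace ℝ (Fin 3))
  (K : EuclideanSpace ℝ (Fin 3) → ℝ)

/-- The helicity-type integrand `F(x,y) = a(x) K(x−y) ⟪f x, f x − f y⟫` (nsreg-p1 `r19/Symmetrisation.lean`). -/
def symF (p : EuclideanSpace ℝ (Fin 3) × EuclideanSpace ℝ (Fin 3)) : ℝ :=
  a p.1 * (K (p.1 - p.2) * inner ℝ (f p.1) (f p.1 - f p.2))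

/-- The Gagliardo integrand `(a x + a y) K(x−y) ‖f x − f y‖²` (nsreg-p1 `r19/Symmetrisation.lean`). -/
def symG (p : EuclideanSpace ℝ (Fin 3) × EuclideanSpace ℝ (Fin 3)) : ℝ :=
  (a p.1 + a p.2) * (K (p.1 - p.2) * ‖f p.1 - f p.2‖ ^ 2)

/-- The error integrand `(a x − a y) K(x−y) ‖f x‖²` (nsreg-p1 `r19/Symmetrisation.lean`). -/
def symS (p : EuclideanSpace ℝ (Fin 3) × EuclideanSpace ℝ (Fin 3)) : ℝ :=
  (a p.1 - a p.2) * K (p.1 - p.2) * ‖f p.1‖ ^ 2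

/-- With the kernel `lamK`, the integral of `symG` is four times the weighted Gagliardo form (definitional bookkeeping). -/
theorem gagliardo_eq_integral_symG :
    gagliardo a f = (1 / 4 : ℝ) * ∫ p : EuclideanSpace ℝ (Fin 3) × EuclideanSpace ℝ (Fin 3), symG a f lamK p :=
  rfl

end Symmetrisation

end Summit.NavierStokesRegularity.NavierStokesRegularity.Theorems.ChiralWindowDoorDefs
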